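import Summits.QuantumFields.BalabanUV.T4Continuum.Support.SmoothRefineInterp
import HarnessLib

/-!
# NE7StencilInverse — THE PERIODIC INVERSE OF THE BINOMIAL STENCIL OF THE WHITNEY LIFT: `interpCore univ (stencilInv N c G) y (const c) = G y`, EXPLICITLY
# (one alternating finite Neumann sum per direction; no Fourier analysis), with translation covariance and the coefficient bound `≤ 1∕(1 − 2c)` per direction
# (lineage `b2b-balaban-t4-ne7b-p1`, gen 162; route (H′) of memo `t4/b2b-balaban-t4-ne7b-p1/g162/records/SCOPING-LEVELMASSES.md` §8∕§9: the exact lift of record `r = W∘A⁻¹`)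

Cell `pub-balaban`, rung (B)+1 sub-cell t4, lineage `b2b-balaban-t4-ne7b-p1` (row NE7b OWNER + CRUX PROVER; junction service for row NE7 on ROAD-G116 §6 (G3)), generation 162.
WHY.  ✓ `NE7WhitneyLiftAverage.linQ_whitneyLift`: the flat straight average of the Whitney-type lift `W` is the BINOMIAL STENCIL `B_c φ (y,κ) = interpCore univ (φ·κ) y (const c)`,
`c = (M−1)∕(2M)`; ✓ `cpush_flatCfg_whitneyLift`: `cpush_1 (Wφ) = gaugeDir_1(Θφ) + B_c φ`; ✓ `cpush_flatCfg_whitneyLift_gaugeDir`: gauge directions are reproduced exactly.  Hence the EXACT one-step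
lift of record is EXPLICIT: `r w := W(B_c⁻¹w − gaugeDir_1(Θ B_c⁻¹ w))` (memo §9) — once `B_c` is inverted on periodic fields.  `B_c = Π_μ ((1−c)·1 + c·τ_μ)` (✓ `interpCore_insert`), and for
`0 ≤ c < 1∕2` each factor is inverted on `N`-periodic fields by the alternating finite Neumann sum `((1−c)(1 − (−q)^N))⁻¹ Σ_{k<N} (−q)^k τ_μ^k`, `q = c∕(1−c) < 1` (since `τ_μ^N = 1`).  THIS FILE
builds that inverse and proves the inversion; no Fourier analysis, no limits.
WHAT ([folklore]; three DATA defs, 0 sorry; `X` any real vector space, `d` arbitrary):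
§1 `stencil1 i a b G y = a•G y + b•G (y + e_i)`, **`stencilInv1 i N a b G y = (a(1 − (−b∕a)^N))⁻¹ • Σ_{k<N} (−b∕a)^k • G (y + k•e_i)`**, and **`stencil1_stencilInv1`**: for `G` `N`-periodic in
   direction `i`, `a ≠ 0`, `(−b∕a)^N ≠ 1`: `stencil1 i a b (stencilInv1 i N a b G) = G` (telescoping); translation covariance `stencilInv1_shift`, periodicity `stencilInv1_periodic`, additivity∕homogeneity;
§2 **`stencilInvList l N a b`** = the iterate over a list of directions (`List.foldr`), `interpCore_insert_stencil1` (`interpCore (insert i S) G y (const c) = interpCore S (stencil1 i (1−c) c G) y (const c)`),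
   and **`interpCore_stencilInvList`**: for `l.Nodup` and `G` periodic in every direction, `interpCore l.toFinset (stencilInvList l N (1−c) c G) y (const c) = G y`;
§3 **`stencilInv N c := stencilInvList (List.finRange d) N (1−c) c`** and the headline **`interpCore_stencilInv`** (`0 ≤ c < 1∕2`, `1 ≤ N`, `G` `N`-periodic):
   `interpCore univ (stencilInv N c G) y (fun _ => c) = G y`; `stencilInv_shift`, `stencilInv_periodic`, `stencilInv_add`, `stencilInv_smul`;
§4 the size of the coefficients: `stencilInv1_coeff_le` — `|(a(1−(−b∕a)^N))⁻¹|·Σ_{k<N} |b∕a|^k ≤ 1∕(1 − 2c)` at `a = 1 − c`, `b = c`, `0 ≤ c < 1∕2` (= `M` at `c = (M−1)∕2M`; the per-direction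
   norm of `B_c⁻¹` in every translation-invariant norm; the `ℓ²` letters are the lift file's).
HONEST FRAMING (page 1): elementary algebra of OUR lift's stencil; nothing of Bałaban's asserted ([Balaban1985Averaging] (47)–(48), (122)∕(125) context only); NOT the lift, NOT (G3), NOT (G), NOT NE7∕NE3
as spine nodes; row NE7b NOT PRINTED ∕ NOT PROVED; spine 0∕9; finite T⁴ rung (B)+1 — NOT infinite volume, NOT mass gap, NOT BetaPertH, NOT Clay.
-/

set_option autoImplicit false

open scoped BigOperators
open Finset

namespace Summit.QuantumFields.BalabanUV.T4Continuum.NE7StencilInverse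

open Literature.MathematicalPhysics.QuantumFieldTheory.Balaban1983to89
open B7Prop1Explicit
open SmoothRefineInterp (interpCore interpCore_empty interpCore_insert interpCore_add interpCore_smul interpCore_shift)

noncomputable section

variable {d : ℕ} {X : Type*} [AddCommGroup X] [Module ℝ X]

/-! ## §1 One direction: the stencil `a·1 + b·τ_i` and its periodic inverse -/

/-- The one-direction stencil `(a·1 + b·τ_i) G (y) = a•G y + b•G (y + e_i)`. [folklore] -/
def stencil1 (i : Fin d) (a b : ℝ) (G : Site d → X) : Site d → X := fun y => a • G y + b • G (y + e i)

/-- **THE PERIODIC INVERSE OF THE ONE-DIRECTION STENCIL**: `stencilInv1 i N a b G y = (a(1 − (−b∕a)^N))⁻¹ • Σ_{k<N} (−b∕a)^k • G (y + k•e_i)` (the alternating Neumann sum, finite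
because `τ_i^N = 1` on `N`-periodic fields). [folklore] -/
def stencilInv1 (i : Fin d) (N : ℕ) (a b : ℝ) (G : Site d → X) : Site d → X :=
  fun y => (a * (1 - (-b / a) ^ N))⁻¹ • ∑ k ∈ range N, ((-b / a) ^ k) • G (y + ((k : ℕ) : ℤ) • e i)

/-- **INVERSION IN ONE DIRECTION**: for `G` `N`-periodic in direction `i`, `a ≠ 0` and `(−b∕a)^N ≠ 1`, `stencil1 i a b (stencilInv1 i N a b G) y = G y` (telescoping sum). [folklore] -/
theorem stencil1_stencilInv1 (i : Fin d) {N : ℕ} {a b : ℝ} (ha : a ≠ 0) (hr : (-b / a) ^ N ≠ 1) {G : Site d → X}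
    (hG : ∀ y : Site d, G (y + (N : ℤ) • e i) = G y) (y : Site d) :
    stencil1 i a b (stencilInv1 i N a b G) y = G y := by
  set r : ℝ := -b / a with hrdef
  set K : ℝ := (a * (1 - r ^ N))⁻¹ with hK
  set f : ℕ → X := fun k => (r ^ k) • G (y + ((k : ℕ) : ℤ) • e i) with hf
  have hb : b = -(a * r) := by rw [hrdef]; field_simp
  -- the shifted sum is `Σ_k r^k • G (y + (k+1)•e_i) = Σ_k (r^k) • (f (k+1) scaled back)`
  have hshift : ∑ k ∈ range N, (r ^ k) • G (y + e i + ((k : ℕ) : ℤ) • e i) = ∑ k ∈ range N, (r ^ k) • G (y + (((k + 1 : ℕ) : ℕ) : ℤ) • e i) := by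
    refine Finset.sum_congr rfl fun k _ => ?_
    congr 1
    push_cast
    rw [add_assoc, add_smul, one_smul, add_comm (e i)]
  have hterm : ∀ k : ℕ, a • f k + b • ((r ^ k) • G (y + (((k + 1 : ℕ) : ℕ) : ℤ) • e i)) = a • (f k - f (k + 1)) := by
    intro k
    simp only [hf]
    rw [hb, neg_smul, mul_smul, smul_smul r, ← pow_succ', smul_sub, sub_eq_add_neg]
  have htel : a • ∑ k ∈ range N, f k + b • ∑ k ∈ range N, (r ^ k) • G (y + (((k + 1 : ℕ) : ℕ) : ℤ) • e i)
      = a • (f 0 - f N) := by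
    rw [← Finset.sum_range_sub' f N, Finset.smul_sum, Finset.smul_sum, Finset.smul_sum, ← Finset.sum_add_distrib]
    exact Finset.sum_congr rfl fun k _ => hterm k
  have h0 : f 0 = G y := by simp [hf]
  have hN : f N = (r ^ N) • G y := by simp only [hf]; rw [hG]
  have h1 : 1 - r ^ N ≠ 0 := sub_ne_zero.mpr (Ne.symm hr)
  show a • (K • ∑ k ∈ range N, f k) + b • (K • ∑ k ∈ range N, (r ^ k) • G (y + e i + ((k : ℕ) : ℤ) • e i)) = G y
  rw [smul_comm a K, smul_comm b K, ← smul_add, hshift, htel, h0, hN,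
    show G y - r ^ N • G y = (1 - r ^ N) • G y by rw [sub_smul, one_smul], smul_smul, smul_smul, hK,
    show (a * (1 - r ^ N))⁻¹ * a * (1 - r ^ N) = 1 by field_simp, one_smul]

/-- Translation covariance: `stencilInv1 i N a b (G(· + v)) y = stencilInv1 i N a b G (y + v)`. [folklore] -/
theorem stencilInv1_shift (i : Fin d) (N : ℕ) (a b : ℝ) (G : Site d → X) (v y : Site d) :
    stencilInv1 i N a b (fun x => G (x + v)) y = stencilInv1 i N a b G (y + v) := by
  simp only [stencilInv1, add_right_comm]

/-- Periodicity is preserved: if `G` is `P`-periodic in direction `j`, so is `stencilInv1 i N a b G`. [folklore] -/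
theorem stencilInv1_periodic (i : Fin d) (N : ℕ) (a b : ℝ) {G : Site d → X} {P : ℤ} {j : Fin d} (hG : ∀ y : Site d, G (y + P • e j) = G y)
    (y : Site d) : stencilInv1 i N a b G (y + P • e j) = stencilInv1 i N a b G y := by
  simp only [stencilInv1, add_right_comm _ (P • e j), hG]

/-- Additivity in the field. [folklore] -/
theorem stencilInv1_add (i : Fin d) (N : ℕ) (a b : ℝ) (G H : Site d → X) (y : Site d) :
    stencilInv1 i N a b (fun x => G x + H x) y = stencilInv1 i N a b G y + stencilInv1 i N a b H y := by
  simp only [stencilInv1, smul_add, Finset.sum_add_distrib]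

/-- Real homogeneity in the field. [folklore] -/
theorem stencilInv1_smul (i : Fin d) (N : ℕ) (a b : ℝ) (t : ℝ) (G : Site d → X) (y : Site d) :
    stencilInv1 i N a b (fun x => t • G x) y = t • stencilInv1 i N a b G y := by
  simp only [stencilInv1, Finset.smul_sum, smul_comm t]

/-! ## §2 Several directions: the iterated inverse against `interpCore` with constant weights -/

/-- **THE ITERATED INVERSE** over a list of directions: `stencilInvList [] = id`, `stencilInvList (i :: l) = stencilInv1 i ∘ stencilInvList l`. [folklore] -/
def stencilInvList (l : List (Fin d)) (N : ℕ) (a b : ℝ) (G : Site d → X) : Site d → X :=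
  l.foldr (fun i H => stencilInv1 i N a b H) G

/-- `stencilInvList [] = id`. [folklore] -/
@[simp] theorem stencilInvList_nil (N : ℕ) (a b : ℝ) (G : Site d → X) : stencilInvList ([] : List (Fin d)) N a b G = G := rfl

/-- `stencilInvList (i :: l) = stencilInv1 i ∘ stencilInvList l`. [folklore] -/
theorem stencilInvList_cons (i : Fin d) (l : List (Fin d)) (N : ℕ) (a b : ℝ) (G : Site d → X) :
    stencilInvList (i :: l) N a b G = stencilInv1 i N a b (stencilInvList l N a b G) := rfl

/-- Periodicity is preserved by the iterated inverse. [folklore] -/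
theorem stencilInvList_periodic (l : List (Fin d)) (N : ℕ) (a b : ℝ) {G : Site d → X} {P : ℤ} {j : Fin d}
    (hG : ∀ y : Site d, G (y + P • e j) = G y) : ∀ y : Site d, stencilInvList l N a b G (y + P • e j) = stencilInvList l N a b G y := by
  induction l with
  | nil => exact hG
  | cons i l ih => intro y; rw [stencilInvList_cons]; exact stencilInv1_periodic i N a b ih y

/-- Translation covariance of the iterated inverse. [folklore] -/
theorem stencilInvList_shift (l : List (Fin d)) (N : ℕ) (a b : ℝ) : ∀ (G : Site d → X) (v y : Site d),
    stencilInvList l N a b (fun x => G (x + v)) y = stencilInvList l N a b G (y + v) := by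
  induction l with
  | nil => intro G v y; rfl
  | cons i l ih =>
      intro G v y
      rw [stencilInvList_cons, stencilInvList_cons, ← stencilInv1_shift]
      congr 1
      funext x
      exact ih G v x

/-- Additivity of the iterated inverse. [folklore] -/
theorem stencilInvList_add (l : List (Fin d)) (N : ℕ) (a b : ℝ) : ∀ (G H : Site d → X) (y : Site d),
    stencilInvList l N a b (fun x => G x + H x) y = stencilInvList l N a b G y + stencilInvList l N a b H y := by
  induction l with
  | nil => intro G H y; rfl
  | cons i l ih =>
      intro G H y
      rw [stencilInvList_cons, stencilInvList_cons, stencilInvList_cons, ← stencilInv1_add]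
      congr 1
      funext x
      exact ih G H x

/-- Real homogeneity of the iterated inverse. [folklore] -/
theorem stencilInvList_smul (l : List (Fin d)) (N : ℕ) (a b : ℝ) (t : ℝ) : ∀ (G : Site d → X) (y : Site d),
    stencilInvList l N a b (fun x => t • G x) y = t • stencilInvList l N a b G y := by
  induction l with
  | nil => intro G y; rfl
  | cons i l ih =>
      intro G y
      rw [stencilInvList_cons, stencilInvList_cons, ← stencilInv1_smul]
      congr 1
      funext x
      exact ih G x

/-- One direction of `interpCore` with constant weight `c` is the stencil `(1−c)·1 + c·τ_i`:
`interpCore (insert i S) G y (const c) = interpCore S (stencil1 i (1−c) c G) y (const c)` (`i ∉ S`). [folklore] -/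
theorem interpCore_insert_stencil1 {S : Finset (Fin d)} {i : Fin d} (hi : i ∉ S) (c : ℝ) (G : Site d → X) (y : Site d) :
    interpCore (insert i S) G y (fun _ => c) = interpCore S (stencil1 i (1 - c) c G) y (fun _ => c) := by
  rw [interpCore_insert hi]
  unfold stencil1
  rw [interpCore_add, interpCore_smul, interpCore_smul]

/-- **INVERSION OVER A LIST OF DIRECTIONS**: for `l` without duplicates, `G` `N`-periodic in every direction, `1 − c ≠ 0` and `(−c∕(1−c))^N ≠ 1`:
`interpCore l.toFinset (stencilInvList l N (1−c) c G) y (const c) = G y`. [folklore] -/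
theorem interpCore_stencilInvList {N : ℕ} {c : ℝ} (ha : 1 - c ≠ 0) (hr : (-c / (1 - c)) ^ N ≠ 1) :
    ∀ (l : List (Fin d)), l.Nodup → ∀ {G : Site d → X}, (∀ (j : Fin d) (y : Site d), G (y + (N : ℤ) • e j) = G y) →
      ∀ y : Site d, interpCore l.toFinset (stencilInvList l N (1 - c) c G) y (fun _ => c) = G y := by
  intro l
  induction l with
  | nil => intro _ G _ y; simp [interpCore_empty]
  | cons i l ih =>
      intro hnd G hG y
      obtain ⟨hil, hl⟩ := List.nodup_cons.mp hnd
      have hiS : i ∉ l.toFinset := fun h => hil (List.mem_toFinset.mp h)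
      rw [List.toFinset_cons, stencilInvList_cons, interpCore_insert_stencil1 hiS]
      have hH : ∀ y : Site d, stencilInvList l N (1 - c) c G (y + (N : ℤ) • e i) = stencilInvList l N (1 - c) c G y :=
        stencilInvList_periodic l N (1 - c) c (hG i)
      have hfix : stencil1 i (1 - c) c (stencilInv1 i N (1 - c) c (stencilInvList l N (1 - c) c G)) = stencilInvList l N (1 - c) c G := by
        funext x
        exact stencil1_stencilInv1 i ha hr hH x
      rw [hfix]
      exact ih hl hG y

/-! ## §3 All directions: `stencilInv` and the headline -/

/-- **THE PERIODIC INVERSE OF THE BINOMIAL STENCIL** with parameter `c` on `N`-periodic fields: `stencilInv N c := stencilInvList (List.finRange d) N (1−c) c`. [folklore] -/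
def stencilInv (N : ℕ) (c : ℝ) (G : Site d → X) : Site d → X := stencilInvList (List.finRange d) N (1 - c) c G

/-- For `0 ≤ c < 1∕2`: `1 − c ≠ 0` and `(−c∕(1−c))^N ≠ 1` for `N ≥ 1`. [folklore] -/
theorem stencil_params {c : ℝ} (hc0 : 0 ≤ c) (hc : c < 1 / 2) {N : ℕ} (hN : 1 ≤ N) :
    1 - c ≠ 0 ∧ (-c / (1 - c)) ^ N ≠ 1 := by
  have ha : 0 < 1 - c := by linarith
  refine ⟨ha.ne', fun h => ?_⟩
  have hq : |(-c / (1 - c))| < 1 := by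
    rw [abs_div, abs_neg, abs_of_nonneg hc0, abs_of_pos ha, div_lt_one ha]
    linarith
  have h1 : |(-c / (1 - c))| ^ N < 1 := pow_lt_one₀ (abs_nonneg _) hq (by omega)
  rw [← abs_pow, h, abs_one] at h1
  exact lt_irrefl _ h1

/-- **HEADLINE — `interpCore univ (stencilInv N c G) y (const c) = G y`** for `0 ≤ c < 1∕2`, `N ≥ 1` and `G` `N`-periodic in every direction: the binomial stencil of the Whitney lift
(✓ `NE7WhitneyLiftAverage.linQ_whitneyLift`, `c = (M−1)∕(2M)`) is inverted on periodic fields, explicitly. [folklore] -/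
theorem interpCore_stencilInv {c : ℝ} (hc0 : 0 ≤ c) (hc : c < 1 / 2) {N : ℕ} (hN : 1 ≤ N) {G : Site d → X}
    (hG : ∀ (j : Fin d) (y : Site d), G (y + (N : ℤ) • e j) = G y) (y : Site d) :
    interpCore Finset.univ (stencilInv N c G) y (fun _ => c) = G y := by
  obtain ⟨ha, hr⟩ := stencil_params hc0 hc hN
  rw [← List.toFinset_finRange]
  exact interpCore_stencilInvList ha hr (List.finRange d) (List.nodup_finRange d) hG y

/-- Translation covariance of `stencilInv`. [folklore] -/
theorem stencilInv_shift (N : ℕ) (c : ℝ) (G : Site d → X) (v y : Site d) :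
    stencilInv N c (fun x => G (x + v)) y = stencilInv N c G (y + v) :=
  stencilInvList_shift _ N _ _ G v y

/-- Periodicity is preserved by `stencilInv`. [folklore] -/
theorem stencilInv_periodic (N : ℕ) (c : ℝ) {G : Site d → X} {P : ℤ} {j : Fin d} (hG : ∀ y : Site d, G (y + P • e j) = G y) (y : Site d) :
    stencilInv N c G (y + P • e j) = stencilInv N c G y :=
  stencilInvList_periodic _ N _ _ hG y

/-- Additivity of `stencilInv`. [folklore] -/
theorem stencilInv_add (N : ℕ) (c : ℝ) (G H : Site d → X) (y : Site d) :
    stencilInv N c (fun x => G x + H x) y = stencilInv N c G y + stencilInv N c H y :=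
  stencilInvList_add _ N _ _ G H y

/-- Real homogeneity of `stencilInv`. [folklore] -/
theorem stencilInv_smul (N : ℕ) (c : ℝ) (t : ℝ) (G : Site d → X) (y : Site d) :
    stencilInv N c (fun x => t • G x) y = t • stencilInv N c G y :=
  stencilInvList_smul _ N _ _ t G y

/-- `stencilInv` of the zero field is zero. [folklore] -/
theorem stencilInv_zero (N : ℕ) (c : ℝ) (y : Site d) : stencilInv N c (fun _ : Site d => (0 : X)) y = 0 := by
  have h := stencilInv_smul (X := X) N c 0 (fun _ => 0) y
  simp only [zero_smul] at h
  exact h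

/-! ## §4 The size of the coefficients: `≤ 1∕(1 − 2c)` per direction -/

/-- **COEFFICIENT BOUND**: at `a = 1 − c`, `b = c`, `0 ≤ c < 1∕2`, `N ≥ 1`: `|(a(1 − (−b∕a)^N))⁻¹| · Σ_{k<N} |−b∕a|^k ≤ 1∕(1 − 2c)` — the per-direction norm of the inverse stencil in every
translation-invariant norm (`= M` at `c = (M−1)∕(2M)`). [folklore] -/
theorem stencilInv1_coeff_le {c : ℝ} (hc0 : 0 ≤ c) (hc : c < 1 / 2) {N : ℕ} (hN : 1 ≤ N) :
    |((1 - c) * (1 - (-c / (1 - c)) ^ N))⁻¹| * ∑ k ∈ range N, |(-c / (1 - c))| ^ k ≤ 1 / (1 - 2 * c) := by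
  have ha : 0 < 1 - c := by linarith
  set q : ℝ := c / (1 - c) with hq
  have hq0 : 0 ≤ q := div_nonneg hc0 ha.le
  have hq1 : q < 1 := by rw [hq, div_lt_one ha]; linarith
  have habs : |(-c / (1 - c))| = q := by rw [neg_div, abs_neg, hq, abs_of_nonneg (div_nonneg hc0 ha.le)]
  rw [habs]
  have hqN : q ^ N < 1 := pow_lt_one₀ hq0 hq1 (by omega)
  -- `|1 − (−q)^N| ≥ 1 − q^N > 0`
  have hden : 1 - q ^ N ≤ |1 - (-c / (1 - c)) ^ N| := by
    have h1 : |(-c / (1 - c)) ^ N| = q ^ N := by rw [abs_pow, habs]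
    have h2 : 1 - |(-c / (1 - c)) ^ N| ≤ |1 - (-c / (1 - c)) ^ N| := by
      have := abs_sub_abs_le_abs_sub (1 : ℝ) ((-c / (1 - c)) ^ N)
      rwa [abs_one] at this
    rw [h1] at h2
    exact h2
  have hden0 : 0 < 1 - q ^ N := by linarith
  -- the geometric sum
  have hgeom : ∑ k ∈ range N, q ^ k = (1 - q ^ N) / (1 - q) := by
    rw [geom_sum_eq hq1.ne N, div_eq_div_iff (by linarith) (by linarith)]
    ring
  rw [hgeom, abs_inv, abs_mul, abs_of_pos ha]
  have hq' : 1 - q = (1 - 2 * c) / (1 - c) := by rw [hq]; field_simp; ring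
  have h2c : 0 < 1 - 2 * c := by linarith
  calc ((1 - c) * |1 - (-c / (1 - c)) ^ N|)⁻¹ * ((1 - q ^ N) / (1 - q))
      ≤ ((1 - c) * (1 - q ^ N))⁻¹ * ((1 - q ^ N) / (1 - q)) := by
        refine mul_le_mul_of_nonneg_right ?_ (div_nonneg hden0.le (by linarith))
        exact inv_anti₀ (mul_pos ha hden0) (mul_le_mul_of_nonneg_left hden ha.le)
    _ = 1 / (1 - 2 * c) := by rw [hq']; field_simp

end

end Summit.QuantumFields.BalabanUV.T4Continuum.NE7StencilInverse
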